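import Mathlib
import HarnessLib

/-!
# Route `ExtremiserTransience`, crux `NearExtremalTransiencePerFlow` (stmt-NavierStokesRegularity-26567),
# LINE g10-1 «two_thirds» (ideator ns-idea-10 g10), stub S1a `TypicalSelection` — BRICK 4a: TRANSLATE AVERAGING (abstract)

`--supports stmt-NavierStokesRegularity-26567` (helper; prover seat ns-net-p2 g12).  The card's step «Chebyshev in the `Z_B`-weight for each
translate `τ`, then AVERAGING OVER `τ`: for enstrophy-most points `y`, some centre within `rλ/2` of `y` carries a good ball» is recorded
here as a self-contained measure-theoretic lemma (no Vitali covering is needed: the average over the translates of a lattice packing is the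
integral over all centres, by the fundamental-domain identity).

SETTING.  `μ` a finite measure on `ℝ³` (in S1a: `‖curl v‖²·1_Θ dx`), `G ⊆ ℝ³` a measurable set of GOOD CENTRES (in S1a: the centres `c`
whose ball `B(c, rλ)` is a good ball), `ρ > 0` (in S1a: `rλ/2`), `b` a basis of `ℝ³` (in S1a: `4rλ·eᵢ`), `Λ = span_ℤ b` its lattice and
`Q` its fundamental parallelepiped.  For a translate `τ`, the packing is `{B(g + τ, ·)}_{g ∈ Λ}` and its BAD INNER WEIGHT is
`Σ_{g ∈ Λ, g+τ ∉ G} μ(B(g + τ, ρ))`.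

* `lintegral_indicator_measure_ball_eq` — Tonelli: `∫ 1_{Gᶜ}(c) μ(B(c,ρ)) dc = ∫ vol(Gᶜ ∩ B(y,ρ)) dμ(y)`;
* `volume_ball_mul_measure_uncovered_le` — the UNCOVERED set `{y : no good centre within distance < ρ}` (closed) satisfies
  `vol(B_ρ) · μ(uncovered) ≤ ∫ 1_{Gᶜ}(c) μ(B(c,ρ)) dc`;
* `lintegral_eq_setLIntegral_tsum_lattice` — fundamental domain: `∫ h(c) dc = ∫_{τ ∈ Q} Σ_{g ∈ Λ} h(g + τ) dτ`;
* `volume_ball_mul_measure_uncovered_le_of_packings` — CONCLUSION: if every translate's bad inner weight is `≤ B₀`, then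
  `vol(B(0,ρ)) · μ(uncovered) ≤ vol(Q) · B₀` (in S1a: `vol(Q)/vol(B_ρ) = 4³·8·3/(4π) = 384/π`, scale-free).
HONEST FRAMING: abstract measure theory; nothing about Navier–Stokes is proved; no summit is proved by a line. [folklore]
-/

noncomputable section

open scoped Topology ENNReal NNReal Pointwise
open MeasureTheory Filter Set Metric Function

namespace Summit.NavierStokesRegularity.NavierStokesRegularity.Theorems.NearExtremalTransiencePerFlow.TwoThirds

-- the problem directory repeats the summit name (`NavierStokesRegularity/NavierStokesRegularity`)
set_option linter.dupNamespace false
set_option linter.style.longLine false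

/-- The set of points with NO good centre at distance `< ρ` is closed (its complement is the open `ρ`-thickening of `G`). -/
theorem isClosed_uncovered (G : Set (EuclideanSpace ℝ (Fin 3))) (ρ : ℝ) : IsClosed {y : (EuclideanSpace ℝ (Fin 3)) | ∀ c, dist c y < ρ → c ∉ G} := by
  have h : {y : (EuclideanSpace ℝ (Fin 3)) | ∀ c, dist c y < ρ → c ∉ G} = (⋃ c ∈ G, Metric.ball c ρ)ᶜ := by
    ext y
    simp only [mem_setOf_eq, mem_compl_iff, mem_iUnion, Metric.mem_ball, exists_prop, not_exists, not_and]
    constructor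
    · intro h c hc hyc
      exact h c (by rwa [dist_comm]) hc
    · intro h c hcy hc
      exact h c hc (by rwa [dist_comm])
  rw [h]
  exact (isOpen_biUnion fun c _ => Metric.isOpen_ball).isClosed_compl

/-- **Tonelli for the incidence set** `{(y, c) : c ∉ G, dist c y < ρ}`:
`∫ 1_{Gᶜ}(c) · μ(B(c, ρ)) dc = ∫ vol(Gᶜ ∩ B(y, ρ)) dμ(y)`. -/
theorem lintegral_indicator_measure_ball_eq (μ : Measure (EuclideanSpace ℝ (Fin 3))) [SFinite μ] {G : Set (EuclideanSpace ℝ (Fin 3))} (hG : MeasurableSet G) (ρ : ℝ) :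
    ∫⁻ c, Gᶜ.indicator (fun c => μ (Metric.ball c ρ)) c = ∫⁻ y, volume (Gᶜ ∩ Metric.ball y ρ) ∂μ := by
  -- the incidence set, as a subset of `(EuclideanSpace ℝ (Fin 3)) × (EuclideanSpace ℝ (Fin 3))` with coordinates `(y, c)`
  obtain ⟨T, hT⟩ : ∃ T : Set ((EuclideanSpace ℝ (Fin 3)) × (EuclideanSpace ℝ (Fin 3))), T = {p | p.2 ∉ G ∧ dist p.2 p.1 < ρ} := ⟨_, rfl⟩
  have hmemT : ∀ y c : (EuclideanSpace ℝ (Fin 3)), (y, c) ∈ T ↔ c ∉ G ∧ dist c y < ρ := fun y c => by rw [hT]; rfl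
  have hTm : MeasurableSet T := by
    have h1 : MeasurableSet {p : (EuclideanSpace ℝ (Fin 3)) × (EuclideanSpace ℝ (Fin 3)) | p.2 ∉ G} := hG.compl.preimage measurable_snd
    have h2 : MeasurableSet {p : (EuclideanSpace ℝ (Fin 3)) × (EuclideanSpace ℝ (Fin 3)) | dist p.2 p.1 < ρ} :=
      measurableSet_lt (continuous_snd.dist continuous_fst).measurable measurable_const
    rw [hT]; exact h1.inter h2
  have hΦ : Measurable (T.indicator (1 : (EuclideanSpace ℝ (Fin 3)) × (EuclideanSpace ℝ (Fin 3)) → ℝ≥0∞)) := measurable_one.indicator hTm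
  -- the curried integrand and its measurability on the product
  set f : (EuclideanSpace ℝ (Fin 3)) → (EuclideanSpace ℝ (Fin 3)) → ℝ≥0∞ := fun c y => T.indicator 1 (y, c) with hf
  have hfm : Measurable (uncurry f) := by
    have : uncurry f = T.indicator (1 : (EuclideanSpace ℝ (Fin 3)) × (EuclideanSpace ℝ (Fin 3)) → ℝ≥0∞) ∘ Prod.swap := by
      funext p; rfl
    rw [this]; exact hΦ.comp measurable_swap
  -- slices
  have hslice_y : ∀ y : (EuclideanSpace ℝ (Fin 3)), ∫⁻ c, f c y = volume (Gᶜ ∩ Metric.ball y ρ) := by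
    intro y
    have hs : (fun c => f c y) = (Gᶜ ∩ Metric.ball y ρ).indicator 1 := by
      funext c
      by_cases hc : c ∈ Gᶜ ∩ Metric.ball y ρ
      · rw [Set.indicator_of_mem hc]
        have : (y, c) ∈ T := (hmemT y c).2 ⟨hc.1, Metric.mem_ball.1 hc.2⟩
        simp only [hf, Set.indicator_of_mem this, Pi.one_apply]
      · rw [Set.indicator_of_notMem hc]
        have : (y, c) ∉ T := fun h => hc ⟨((hmemT y c).1 h).1, Metric.mem_ball.2 ((hmemT y c).1 h).2⟩
        simp only [hf, Set.indicator_of_notMem this]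
    rw [hs, lintegral_indicator_one (hG.compl.inter measurableSet_ball)]
  have hslice_c : ∀ c : (EuclideanSpace ℝ (Fin 3)), ∫⁻ y, f c y ∂μ = Gᶜ.indicator (fun c => μ (Metric.ball c ρ)) c := by
    intro c
    by_cases hc : c ∈ G
    · have hs : (fun y => f c y) = fun _ => 0 := by
        funext y
        have : (y, c) ∉ T := fun h => ((hmemT y c).1 h).1 hc
        simp only [hf, Set.indicator_of_notMem this]
      rw [hs, lintegral_zero, Set.indicator_of_notMem (show c ∉ Gᶜ by simpa using hc)]
    · have hs : (fun y => f c y) = (Metric.ball c ρ).indicator 1 := by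
        funext y
        by_cases hy : y ∈ Metric.ball c ρ
        · rw [Set.indicator_of_mem hy]
          have : (y, c) ∈ T := (hmemT y c).2 ⟨hc, by rw [dist_comm]; exact Metric.mem_ball.1 hy⟩
          simp only [hf, Set.indicator_of_mem this, Pi.one_apply]
        · rw [Set.indicator_of_notMem hy]
          have : (y, c) ∉ T := fun h => hy (Metric.mem_ball.2 (by rw [dist_comm]; exact ((hmemT y c).1 h).2))
          simp only [hf, Set.indicator_of_notMem this]
      rw [hs, lintegral_indicator_one measurableSet_ball, Set.indicator_of_mem (show c ∈ Gᶜ from hc)]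
  calc ∫⁻ c, Gᶜ.indicator (fun c => μ (Metric.ball c ρ)) c
      = ∫⁻ c, ∫⁻ y, f c y ∂μ := lintegral_congr fun c => (hslice_c c).symm
    _ = ∫⁻ y, ∫⁻ c, f c y ∂volume ∂μ := lintegral_lintegral_swap hfm.aemeasurable
    _ = ∫⁻ y, volume (Gᶜ ∩ Metric.ball y ρ) ∂μ := lintegral_congr fun y => hslice_y y

/-- **Uncovered points are paid for by the bad centres**: `vol(B(0,ρ)) · μ{y : no good centre at distance < ρ} ≤ ∫ 1_{Gᶜ}(c) μ(B(c,ρ)) dc`. -/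
theorem volume_ball_mul_measure_uncovered_le (μ : Measure (EuclideanSpace ℝ (Fin 3))) [SFinite μ] {G : Set (EuclideanSpace ℝ (Fin 3))} (hG : MeasurableSet G) (ρ : ℝ) :
    volume (Metric.ball (0 : (EuclideanSpace ℝ (Fin 3))) ρ) * μ {y : (EuclideanSpace ℝ (Fin 3)) | ∀ c, dist c y < ρ → c ∉ G} ≤
      ∫⁻ c, Gᶜ.indicator (fun c => μ (Metric.ball c ρ)) c := by
  set U : Set (EuclideanSpace ℝ (Fin 3)) := {y : (EuclideanSpace ℝ (Fin 3)) | ∀ c, dist c y < ρ → c ∉ G} with hU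
  have hUm : MeasurableSet U := (isClosed_uncovered G ρ).measurableSet
  rw [lintegral_indicator_measure_ball_eq μ hG ρ]
  calc volume (Metric.ball (0 : (EuclideanSpace ℝ (Fin 3))) ρ) * μ U = ∫⁻ y in U, volume (Metric.ball (0 : (EuclideanSpace ℝ (Fin 3))) ρ) ∂μ := by
        rw [setLIntegral_const]
    _ = ∫⁻ y in U, volume (Gᶜ ∩ Metric.ball y ρ) ∂μ := by
        refine setLIntegral_congr_fun hUm (fun y hy => ?_)
        have hsub : Gᶜ ∩ Metric.ball y ρ = Metric.ball y ρ := by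
          refine inter_eq_right.2 fun c hc => ?_
          exact hy c (Metric.mem_ball.1 hc)
        rw [hsub, Measure.addHaar_ball_center volume y ρ]
    _ ≤ ∫⁻ y, volume (Gᶜ ∩ Metric.ball y ρ) ∂μ := setLIntegral_le_lintegral _ _

/-- **Fundamental-domain identity for a lattice of translates**: `∫ h(c) dc = ∫_{τ ∈ Q} Σ_{g ∈ Λ} h(g + τ) dτ` for the lattice `Λ = span_ℤ b`
and its fundamental parallelepiped `Q`, `h` measurable. -/
theorem lintegral_eq_setLIntegral_tsum_lattice (b : Module.Basis (Fin 3) ℝ (EuclideanSpace ℝ (Fin 3))) {h : (EuclideanSpace ℝ (Fin 3)) → ℝ≥0∞} (hh : Measurable h) :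
    ∫⁻ c, h c = ∫⁻ τ in ZSpan.fundamentalDomain b, ∑' g : (Submodule.span ℤ (Set.range b)).toAddSubgroup, h ((g : (EuclideanSpace ℝ (Fin 3))) + τ) := by
  haveI : Countable (Submodule.span ℤ (Set.range b)).toAddSubgroup :=
    inferInstanceAs (Countable (Submodule.span ℤ (Set.range b)))
  have hF := ZSpan.isAddFundamentalDomain' b (volume : Measure (EuclideanSpace ℝ (Fin 3)))
  rw [hF.lintegral_eq_tsum' h]
  have hvadd : ∀ (g : (Submodule.span ℤ (Set.range b)).toAddSubgroup) (x : (EuclideanSpace ℝ (Fin 3))), g +ᵥ x = (g : (EuclideanSpace ℝ (Fin 3))) + x := fun g x => rfl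
  have hmeas : ∀ g : (Submodule.span ℤ (Set.range b)).toAddSubgroup, AEMeasurable (fun τ => h ((g : (EuclideanSpace ℝ (Fin 3))) + τ))
      ((volume : Measure (EuclideanSpace ℝ (Fin 3))).restrict (ZSpan.fundamentalDomain b)) :=
    fun g => (hh.comp (measurable_const_add _)).aemeasurable
  simp_rw [hvadd]
  rw [lintegral_tsum fun g => hmeas g]
  exact (Equiv.neg ((Submodule.span ℤ (Set.range b)).toAddSubgroup)).tsum_eq
    (fun g => ∫⁻ τ in ZSpan.fundamentalDomain b, h ((g : (EuclideanSpace ℝ (Fin 3))) + τ))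

/-- **Translate averaging (brick 4a of S1a).**  `μ` a finite (or s-finite) measure, `G` a measurable set of good centres, `ρ > 0` arbitrary,
`b` a basis with lattice `Λ = span_ℤ b` and fundamental parallelepiped `Q`.  If for EVERY translate `τ ∈ Q` the bad inner weight of the
packing `{B(g + τ, ·)}_{g ∈ Λ}` is at most `B₀` — `Σ_{g ∈ Λ} 1_{Gᶜ}(g+τ)·μ(B(g+τ, ρ)) ≤ B₀` — then the set of points with NO good centre at
distance `< ρ` has `vol(B(0,ρ)) · μ(·) ≤ vol(Q) · B₀`. [folklore] -/
theorem volume_ball_mul_measure_uncovered_le_of_packings (μ : Measure (EuclideanSpace ℝ (Fin 3))) [SFinite μ] {G : Set (EuclideanSpace ℝ (Fin 3))} (hG : MeasurableSet G)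
    (ρ : ℝ) (b : Module.Basis (Fin 3) ℝ (EuclideanSpace ℝ (Fin 3))) {B₀ : ℝ≥0∞}
    (hbad : ∀ τ ∈ ZSpan.fundamentalDomain b,
      ∑' g : (Submodule.span ℤ (Set.range b)).toAddSubgroup, Gᶜ.indicator (fun c => μ (Metric.ball c ρ)) ((g : (EuclideanSpace ℝ (Fin 3))) + τ) ≤ B₀) :
    volume (Metric.ball (0 : (EuclideanSpace ℝ (Fin 3))) ρ) * μ {y : (EuclideanSpace ℝ (Fin 3)) | ∀ c, dist c y < ρ → c ∉ G} ≤
      volume (ZSpan.fundamentalDomain b) * B₀ := by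
  -- measurability of `c ↦ 1_{Gᶜ}(c) μ(B(c, ρ))` via the Tonelli slice
  have hmeas : Measurable fun c : (EuclideanSpace ℝ (Fin 3)) => Gᶜ.indicator (fun c => μ (Metric.ball c ρ)) c := by
    have hball : Measurable fun c : (EuclideanSpace ℝ (Fin 3)) => μ (Metric.ball c ρ) := by
      have hS : MeasurableSet {p : (EuclideanSpace ℝ (Fin 3)) × (EuclideanSpace ℝ (Fin 3)) | dist p.2 p.1 < ρ} :=
        measurableSet_lt (continuous_snd.dist continuous_fst).measurable measurable_const
      exact measurable_measure_prodMk_left (ν := μ) hS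
    exact hball.indicator hG.compl
  refine (volume_ball_mul_measure_uncovered_le μ hG ρ).trans ?_
  rw [lintegral_eq_setLIntegral_tsum_lattice b hmeas]
  calc ∫⁻ τ in ZSpan.fundamentalDomain b, ∑' g : (Submodule.span ℤ (Set.range b)).toAddSubgroup, Gᶜ.indicator (fun c => μ (Metric.ball c ρ)) ((g : (EuclideanSpace ℝ (Fin 3))) + τ)
      ≤ ∫⁻ _τ in ZSpan.fundamentalDomain b, B₀ := setLIntegral_mono' (ZSpan.fundamentalDomain_measurableSet b) fun τ hτ => hbad τ hτ
    _ = volume (ZSpan.fundamentalDomain b) * B₀ := by rw [setLIntegral_const, mul_comm]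

end Summit.NavierStokesRegularity.NavierStokesRegularity.Theorems.NearExtremalTransiencePerFlow.TwoThirds

end
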